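import Summits.Ventures.PercRepro.Night2SeriesClassesCells

/-!
# PercRepro — **THE `(7, 5)` CELL `(3, 0)` CLOSES ENTIRELY**: `|G| = 11` outright, residues Q (night-2, gen 23)

`localShadowHall_three_zero_six_eleven`: every `G` of the cell `(3, 0)` with `|G| = 11` and a fat thin member
satisfies (LI_G) — with at most four fat thin closures by `Night2SeriesClassFourCellsB`; with five or more: no two fat
missed pairs sharing a point gives four pairwise disjoint ones (`Night2FourFatCells`); a sharing pair gives the
triangle `{p, x, y}`, and two fat thin members beyond its three pairs give a `K₄` (a pair meeting the triangle in one
point), two disjoint triangles (`[3, 3]`) or a triangle and two disjoint pairs (`[3, 2, 2]`).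
`shadowHall_seven_five_of_residuesQ`: the `(7, 5)` shadow row modulo the cells `(2, 0)`, `(2, 1)`, `(3, 1)`, `(3, 2)`.
-/

namespace PercRepro.Shadow

open Finset PerFlat ThmH

variable {α : Type*} [DecidableEq α] {M : Matroid α} [M.Finite]

open scoped Classical in
/-- **A triangle and a fat thin member whose missed pair meets it (and is none of its pairs) give a `K₄`**: (LI_G) at
`|G| = 11` through the `K₄` count. -/
theorem localShadowHall_three_zero_six_eleven_of_triangle_meeting {G : Finset α} (hG : G ∈ flatsQ M (5 + 1))
    (hd : (gr M \ G).card = 3) (hk : kColoops M G = 0)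
    (hs : ∀ e ∈ gr M, ∀ f ∈ gr M, e ≠ f → rkN M {e, f} = 2) (hl : ∀ e ∈ gr M, M.Indep {e})
    (hn : G.card = 11) {p x y : α} (hpx : p ≠ x) (hpy : p ≠ y) (hxy : x ≠ y)
    (hpG : p ∈ G) (hxG : x ∈ G) (hyG : y ∈ G)
    (hH₀ : M.eRk ((G \ {p, x} : Finset α) : Set α) ≤ ((5 : ℕ) : ℕ∞))
    (hH₁ : M.eRk ((G \ {p, y} : Finset α) : Set α) ≤ ((5 : ℕ) : ℕ∞))
    {B₂ : Finset α} (hB₂ : B₂ ∈ thinMembers M 5 G) (hc₂ : (G \ clF M B₂).card = 2)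
    (hQ₀ : G \ clF M B₂ ≠ {p, x}) (hQ₁ : G \ clF M B₂ ≠ {p, y}) (hQ₂ : G \ clF M B₂ ≠ {x, y})
    {a : α} (haQ : a ∈ G \ clF M B₂) (haT : a ∈ ({p, x, y} : Finset α)) :
    LocalShadowHall M 5 G := by
  obtain ⟨u, v, huv, hQ⟩ := Finset.card_eq_two.1 hc₂
  have hz : ∃ z, G \ clF M B₂ = {a, z} ∧ a ≠ z := by
    rw [hQ] at haQ ⊢
    rcases Finset.mem_insert.1 haQ with rfl | h
    · exact ⟨v, rfl, huv⟩
    · rw [Finset.mem_singleton] at h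
      subst h
      exact ⟨u, Finset.pair_comm u a, fun h => huv h.symm⟩
  obtain ⟨z, hQz, haz⟩ := hz
  have hzG : z ∈ G := by
    have : z ∈ G \ clF M B₂ := by rw [hQz]; simp
    exact (Finset.mem_sdiff.1 this).1
  have hztri : z ∉ ({p, x, y} : Finset α) := by
    intro hzt
    rcases pair_eq_of_subset_triangle hpx hpy hxy haz haT hzt with h | h | h
    · exact hQ₀ (hQz.trans h)
    · exact hQ₁ (hQz.trans h)
    · exact hQ₂ (hQz.trans h)
  simp only [Finset.mem_insert, Finset.mem_singleton, not_or] at hztri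
  have ha' : a = p ∨ a = x ∨ a = y := by
    simp only [Finset.mem_insert, Finset.mem_singleton] at haT
    exact haT
  have hHa : M.eRk ((G \ {a, z} : Finset α) : Set α) ≤ ((5 : ℕ) : ℕ∞) := by
    have := eRk_clF_le_of_mem_thinMembers hB₂
    rwa [clF_eq_sdiff_sdiff_of_thin hB₂, hQz] at this
  have hsix := sixCocircuits_of_triangle_and_pair hG hk hpx hpy hxy hpG hxG hyG hzG hH₀ hH₁ ha'
    ⟨hztri.1, hztri.2.1, hztri.2.2⟩ hHa
  exact localShadowHall_three_zero_six_eleven_of_K4 hG hd hk hs hl hn hpx hpy (Ne.symm hztri.1) hxy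
    (Ne.symm hztri.2.1) (Ne.symm hztri.2.2) hsix

open scoped Classical in
/-- With at least five fat thin closures, beyond a triangle `{p, x}, {p, y}` and a further closure `clF B₂` there is a
fat thin member whose missed pair is none of the triangle's pairs and differs from `G ∖ clF B₂`. -/
theorem exists_fat_beyond_four {G : Finset α} (h5 : 5 ≤ (fatClosures M 5 G 2).card)
    {B₀ B₁ B₂ : Finset α} (hB₀ : B₀ ∈ thinMembers M 5 G) (hB₁ : B₁ ∈ thinMembers M 5 G)
    (hB₂ : B₂ ∈ thinMembers M 5 G) {p x y : α}
    (hP₀ : G \ clF M B₀ = {p, x}) (hP₁ : G \ clF M B₁ = {p, y}) :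
    ∃ B₃ ∈ thinMembers M 5 G, (G \ clF M B₃).card ≤ 2 ∧ G \ clF M B₃ ≠ {p, x} ∧ G \ clF M B₃ ≠ {p, y} ∧
      G \ clF M B₃ ≠ {x, y} ∧ G \ clF M B₃ ≠ G \ clF M B₂ := by
  have hlt : ({clF M B₀, clF M B₁, G \ {x, y}, clF M B₂} : Finset (Finset α)).card < (fatClosures M 5 G 2).card :=
    lt_of_le_of_lt Finset.card_le_four (by omega)
  obtain ⟨H, hH, hHn⟩ := Finset.exists_mem_notMem_of_card_lt_card hlt
  unfold fatClosures at hH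
  rw [Finset.mem_image] at hH
  obtain ⟨B₃, hB₃, rfl⟩ := hH
  rw [Finset.mem_filter] at hB₃
  simp only [Finset.mem_insert, Finset.mem_singleton, not_or] at hHn
  obtain ⟨hn0, hn1, hn2, hn3⟩ := hHn
  refine ⟨B₃, hB₃.1, hB₃.2, ?_, ?_, ?_, ?_⟩
  · intro h; apply hn0
    rw [clF_eq_sdiff_sdiff_of_thin hB₃.1, h, ← hP₀, ← clF_eq_sdiff_sdiff_of_thin hB₀]
  · intro h; apply hn1
    rw [clF_eq_sdiff_sdiff_of_thin hB₃.1, h, ← hP₁, ← clF_eq_sdiff_sdiff_of_thin hB₁]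
  · intro h; apply hn2
    rw [clF_eq_sdiff_sdiff_of_thin hB₃.1, h]
  · intro h; apply hn3
    rw [clF_eq_sdiff_sdiff_of_thin hB₃.1, h, ← clF_eq_sdiff_sdiff_of_thin hB₂]

open scoped Classical in
/-- **THE CELL `(3, 0)` AT `|G| = 11` CLOSES OUTRIGHT** (given a fat thin member). -/
theorem localShadowHall_three_zero_six_eleven {G : Finset α} (hG : G ∈ flatsQ M (5 + 1))
    (hd : (gr M \ G).card = 3) (hk : kColoops M G = 0)
    (hs : ∀ e ∈ gr M, ∀ f ∈ gr M, e ≠ f → rkN M {e, f} = 2) (hl : ∀ e ∈ gr M, M.Indep {e})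
    (hn : G.card = 11) {B₀ : Finset α} (hB₀ : B₀ ∈ thinMembers M 5 G) (hfat : (G \ clF M B₀).card ≤ 2) :
    LocalShadowHall M 5 G := by
  have hd' : (gr M \ G).card ≤ 5 := by omega
  by_cases h4 : (fatClosures M 5 G 2).card ≤ 4
  · exact localShadowHall_three_zero_six_eleven_of_le_four hG hd hk hs hl hn hB₀ hfat h4
  push Not at h4
  have hc : ∀ {B : Finset α}, B ∈ thinMembers M 5 G → (G \ clF M B).card ≤ 2 → (G \ clF M B).card = 2 :=
    fun hB hle => le_antisymm hle
      (two_le_card_sdiff_of_not_lay0 hG hd' (mem_thinMembers.1 hB).1 (mem_thinMembers.1 hB).2)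
  by_cases hshare : ∃ B₀' ∈ thinMembers M 5 G, ∃ B₁ ∈ thinMembers M 5 G, (G \ clF M B₀').card ≤ 2 ∧
      (G \ clF M B₁).card ≤ 2 ∧ G \ clF M B₀' ≠ G \ clF M B₁ ∧ ((G \ clF M B₀') ∩ (G \ clF M B₁)).Nonempty
  · obtain ⟨B₀', hB₀', B₁, hB₁, hf₀, hf₁, hne, ⟨p, hp⟩⟩ := hshare
    obtain ⟨x, y, hP₀, hP₁, hpx, hpy, hxy⟩ := pair_shape_of_mem_inter (hc hB₀' hf₀) (hc hB₁ hf₁) hne hp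
    have hpG : p ∈ G := by
      have : p ∈ G \ clF M B₀' := by rw [hP₀]; simp
      exact (Finset.mem_sdiff.1 this).1
    have hxG : x ∈ G := by
      have : x ∈ G \ clF M B₀' := by rw [hP₀]; simp
      exact (Finset.mem_sdiff.1 this).1
    have hyG : y ∈ G := by
      have : y ∈ G \ clF M B₁ := by rw [hP₁]; simp
      exact (Finset.mem_sdiff.1 this).1
    have hH₀ : M.eRk ((G \ {p, x} : Finset α) : Set α) ≤ ((5 : ℕ) : ℕ∞) := by
      have := eRk_clF_le_of_mem_thinMembers hB₀'
      rwa [clF_eq_sdiff_sdiff_of_thin hB₀', hP₀] at this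
    have hH₁ : M.eRk ((G \ {p, y} : Finset α) : Set α) ≤ ((5 : ℕ) : ℕ∞) := by
      have := eRk_clF_le_of_mem_thinMembers hB₁
      rwa [clF_eq_sdiff_sdiff_of_thin hB₁, hP₁] at this
    have hH₂ : M.eRk ((G \ {x, y} : Finset α) : Set α) ≤ ((5 : ℕ) : ℕ∞) :=
      eRk_sdiff_pair_le_of_series hG hk hH₀ hH₁
        (Finset.sdiff_sdiff_eq_self (Finset.insert_subset hpG (Finset.singleton_subset_iff.2 hxG)))
        (Finset.sdiff_sdiff_eq_self (Finset.insert_subset hpG (Finset.singleton_subset_iff.2 hyG))) hpx hpy hxy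
    -- a fat thin member beyond the triangle
    obtain ⟨B₂, hB₂, hf₂, hQ₀, hQ₁, hQ₂⟩ := exists_fat_beyond_triangle (by omega) hB₀' hB₁ hP₀ hP₁
    have hc₂ := hc hB₂ hf₂
    by_cases hmeet : ((G \ clF M B₂) ∩ {p, x, y}).Nonempty
    · obtain ⟨a, ha⟩ := hmeet
      rw [Finset.mem_inter] at ha
      exact localShadowHall_three_zero_six_eleven_of_triangle_meeting hG hd hk hs hl hn hpx hpy hxy hpG hxG hyG
        hH₀ hH₁ hB₂ hc₂ hQ₀ hQ₁ hQ₂ ha.1 ha.2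
    -- the pair `{u, v}` is disjoint from the triangle
    rw [Finset.not_nonempty_iff_eq_empty] at hmeet
    obtain ⟨u, v, huv, hQ⟩ := Finset.card_eq_two.1 hc₂
    have hQT : ∀ z ∈ ({u, v} : Finset α), z ∉ ({p, x, y} : Finset α) := by
      intro z hz hzT
      have : z ∈ (G \ clF M B₂) ∩ {p, x, y} := Finset.mem_inter.2 ⟨hQ ▸ hz, hzT⟩
      rw [hmeet] at this
      exact Finset.notMem_empty z this
    have huT : u ∉ ({p, x, y} : Finset α) := hQT u (by simp)
    have hvT : v ∉ ({p, x, y} : Finset α) := hQT v (by simp)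
    have hH₃ : M.eRk ((G \ {u, v} : Finset α) : Set α) ≤ ((5 : ℕ) : ℕ∞) := by
      have := eRk_clF_le_of_mem_thinMembers hB₂
      rwa [clF_eq_sdiff_sdiff_of_thin hB₂, hQ] at this
    have huG : u ∈ G := by
      have : u ∈ G \ clF M B₂ := by rw [hQ]; simp
      exact (Finset.mem_sdiff.1 this).1
    have hvG : v ∈ G := by
      have : v ∈ G \ clF M B₂ := by rw [hQ]; simp
      exact (Finset.mem_sdiff.1 this).1
    -- a fifth fat thin member
    obtain ⟨B₃, hB₃, hf₃, hR₀, hR₁, hR₂, hR₃⟩ := exists_fat_beyond_four h4 hB₀' hB₁ hB₂ hP₀ hP₁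
    have hc₃ := hc hB₃ hf₃
    by_cases hmeet₃ : ((G \ clF M B₃) ∩ {p, x, y}).Nonempty
    · obtain ⟨a, ha⟩ := hmeet₃
      rw [Finset.mem_inter] at ha
      exact localShadowHall_three_zero_six_eleven_of_triangle_meeting hG hd hk hs hl hn hpx hpy hxy hpG hxG hyG
        hH₀ hH₁ hB₃ hc₃ hR₀ hR₁ hR₂ ha.1 ha.2
    rw [Finset.not_nonempty_iff_eq_empty] at hmeet₃
    have hRT : ∀ z ∈ G \ clF M B₃, z ∉ ({p, x, y} : Finset α) := by
      intro z hz hzT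
      have : z ∈ (G \ clF M B₃) ∩ {p, x, y} := Finset.mem_inter.2 ⟨hz, hzT⟩
      rw [hmeet₃] at this
      exact Finset.notMem_empty z this
    rw [hQ] at hR₃
    by_cases hmeetQ : ((G \ clF M B₃) ∩ {u, v}).Nonempty
    · -- a second triangle `{u, v, w}`
      obtain ⟨a, ha⟩ := hmeetQ
      rw [Finset.mem_inter] at ha
      obtain ⟨u', v', huv', hR⟩ := Finset.card_eq_two.1 hc₃
      have hw : ∃ w, G \ clF M B₃ = {a, w} ∧ a ≠ w := by
        rw [hR] at ha ⊢
        rcases Finset.mem_insert.1 ha.1 with rfl | h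
        · exact ⟨v', rfl, huv'⟩
        · rw [Finset.mem_singleton] at h
          subst h
          exact ⟨u', Finset.pair_comm u' a, fun h => huv' h.symm⟩
      obtain ⟨w, hRw, haw⟩ := hw
      have hwG : w ∈ G := by
        have : w ∈ G \ clF M B₃ := by rw [hRw]; simp
        exact (Finset.mem_sdiff.1 this).1
      have hwT : w ∉ ({p, x, y} : Finset α) := hRT w (by rw [hRw]; simp)
      have hwQ : w ∉ ({u, v} : Finset α) := by
        intro hwQ
        apply hR₃
        rw [hRw]
        have ha2 := ha.2
        simp only [Finset.mem_insert, Finset.mem_singleton] at ha2 hwQ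
        rcases ha2 with rfl | rfl <;> rcases hwQ with rfl | rfl
        · exact absurd rfl haw
        · rfl
        · exact Finset.pair_comm _ _
        · exact absurd rfl haw
      simp only [Finset.mem_insert, Finset.mem_singleton, not_or] at hwQ
      have hHa : M.eRk ((G \ {a, w} : Finset α) : Set α) ≤ ((5 : ℕ) : ℕ∞) := by
        have := eRk_clF_le_of_mem_thinMembers hB₃
        rwa [clF_eq_sdiff_sdiff_of_thin hB₃, hRw] at this
      have hsd : ∀ {a b : α}, a ∈ G → b ∈ G → G \ (G \ {a, b}) = {a, b} := fun ha hb =>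
        Finset.sdiff_sdiff_eq_self (Finset.insert_subset ha (Finset.singleton_subset_iff.2 hb))
      -- the two missing pairs of the second triangle
      have hH₄₅ : M.eRk ((G \ {u, w} : Finset α) : Set α) ≤ ((5 : ℕ) : ℕ∞) ∧
          M.eRk ((G \ {v, w} : Finset α) : Set α) ≤ ((5 : ℕ) : ℕ∞) := by
        have ha2 := ha.2
        simp only [Finset.mem_insert, Finset.mem_singleton] at ha2
        rcases ha2 with rfl | rfl
        · exact ⟨hHa, eRk_sdiff_pair_le_of_series hG hk hH₃ hHa (hsd huG hvG) (hsd huG hwG) huv (Ne.symm hwQ.1)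
            (Ne.symm hwQ.2)⟩
        · have hH₃' : M.eRk ((G \ {a, u} : Finset α) : Set α) ≤ ((5 : ℕ) : ℕ∞) := by
            rwa [Finset.pair_comm] at hH₃
          exact ⟨eRk_sdiff_pair_le_of_series hG hk hH₃' hHa (hsd hvG huG) (hsd hvG hwG) (Ne.symm huv)
            (Ne.symm hwQ.2) (Ne.symm hwQ.1), hHa⟩
      have hdisj : Disjoint ({p, x, y} : Finset α) {u, v, w} := by
        rw [Finset.disjoint_left]
        intro z hz hz'
        simp only [Finset.mem_insert, Finset.mem_singleton] at hz'
        rcases hz' with rfl | rfl | rfl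
        · exact huT hz
        · exact hvT hz
        · exact hwT hz
      exact localShadowHall_three_zero_six_eleven_of_twoTriangles hG hd hk hs hl hn hpx hpy hxy huv
        (Ne.symm hwQ.1) (Ne.symm hwQ.2) hdisj hH₀ hH₁ hH₂ hH₃ hH₄₅.1 hH₄₅.2
    · -- a third pairwise disjoint class
      rw [Finset.not_nonempty_iff_eq_empty] at hmeetQ
      obtain ⟨u', v', huv', hR⟩ := Finset.card_eq_two.1 hc₃
      have hH₄ : M.eRk ((G \ {u', v'} : Finset α) : Set α) ≤ ((5 : ℕ) : ℕ∞) := by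
        have := eRk_clF_le_of_mem_thinMembers hB₃
        rwa [clF_eq_sdiff_sdiff_of_thin hB₃, hR] at this
      have hd₁ : Disjoint ({p, x, y} : Finset α) {u, v} := by
        rw [Finset.disjoint_left]
        intro z hz hz'
        exact hQT z hz' hz
      have hd₂ : Disjoint ({p, x, y} : Finset α) {u', v'} := by
        rw [Finset.disjoint_left]
        intro z hz hz'
        exact hRT z (hR ▸ hz') hz
      have hd₃ : Disjoint ({u, v} : Finset α) {u', v'} := by
        rw [Finset.disjoint_left]
        intro z hz hz'
        have : z ∈ (G \ clF M B₃) ∩ {u, v} := Finset.mem_inter.2 ⟨hR ▸ hz', hz⟩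
        rw [hmeetQ] at this
        exact Finset.notMem_empty z this
      exact localShadowHall_three_zero_six_eleven_of_triangleTwoPairs hG hd hk hs hl hn hpx hpy hxy huv huv'
        hd₁ hd₂ hd₃ hH₀ hH₁ hH₂ hH₃ hH₄
  · -- no two fat missed pairs share a point: four pairwise disjoint ones
    push Not at hshare
    obtain ⟨B₀', hB₀', B₁, hB₁, B₂, hB₂, hf₀, hf₁, hf₂, h01, h02, h12⟩ :=
      exists_threeFat_of_two_lt_card_fatClosures (M := M) (q := 5) (G := G) (by omega)
    have hlt : ({clF M B₀', clF M B₁, clF M B₂} : Finset (Finset α)).card < (fatClosures M 5 G 2).card :=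
      lt_of_le_of_lt Finset.card_le_three (by omega)
    obtain ⟨H, hH, hHn⟩ := Finset.exists_mem_notMem_of_card_lt_card hlt
    unfold fatClosures at hH
    rw [Finset.mem_image] at hH
    obtain ⟨B₃, hB₃, rfl⟩ := hH
    rw [Finset.mem_filter] at hB₃
    simp only [Finset.mem_insert, Finset.mem_singleton, not_or] at hHn
    have hne3 : ∀ {B : Finset α}, B ∈ thinMembers M 5 G → clF M B₃ ≠ clF M B → G \ clF M B₃ ≠ G \ clF M B := by
      intro B hB hne h
      apply hne
      rw [clF_eq_sdiff_sdiff_of_thin hB₃.1, h, ← clF_eq_sdiff_sdiff_of_thin hB]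
    exact localShadowHall_three_zero_six_eleven_of_fourDisjoint hG hd hk hs hl hn hB₀' hB₁ hB₂ hB₃.1 hf₀ hf₁ hf₂
      hB₃.2 (hshare B₀' hB₀' B₁ hB₁ hf₀ hf₁ h01) (hshare B₀' hB₀' B₂ hB₂ hf₀ hf₂ h02)
      (hshare B₀' hB₀' B₃ hB₃.1 hf₀ hB₃.2 (Ne.symm (hne3 hB₀' hHn.1)))
      (hshare B₁ hB₁ B₂ hB₂ hf₁ hf₂ h12) (hshare B₁ hB₁ B₃ hB₃.1 hf₁ hB₃.2 (Ne.symm (hne3 hB₁ hHn.2.1)))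
      (hshare B₂ hB₂ B₃ hB₃.1 hf₂ hB₃.2 (Ne.symm (hne3 hB₂ hHn.2.2)))

section SevenFiveQ

variable {α' : Type} [DecidableEq α']

/-- **THE `(7, 5)` SHADOW ROW FOR EVERY FINITE MATROID MODULO THE RESIDUES Q**: the cell `(3, 0)` is closed entirely;
what remains are `(2, 0)`, `(2, 1)`, `(3, 1)` (as in the residues K) and `(3, 2)`. -/
theorem shadowHall_seven_five_of_residuesQ
    (h20 : ∀ (N : Matroid α') [N.Finite] (G : Finset α'), CellHyp N G →
      (gr N \ G).card = 2 → kColoops N G = 0 → FatMember N G 6 3 →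
      (FatBasis N G 6 2 ∨ FatMember N G 6 2) → LocalShadowHall N 5 G)
    (h21 : ∀ (N : Matroid α') [N.Finite] (G : Finset α'), CellHyp N G →
      (gr N \ G).card = 2 → kColoops N G = 1 → FatMember N G 5 4 →
      (FatBasis N G 5 3 ∨ FatMember N G 5 3) → LocalShadowHall N 5 G)
    (h31 : ∀ (N : Matroid α') [N.Finite] (G : Finset α'), CellHyp N G →
      (gr N \ G).card = 3 → kColoops N G = 1 → 11 ≤ G.card → G.card ≤ 17 → FatMember N G 5 2 →
      (G.card = 17 → FatBasis N G 5 2) → (G.card = 17 → NestedFat N G 2 3) →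
      (G.card = 16 → MeetingFat N G 2) → (11 ≤ G.card ∧ G.card ≤ 17 → NoThreeDisjointFat N G 2) →
      (G.card = 11 ∨ G.card = 15 ∨ G.card = 16 → FatBasis N G 5 3) →
      (12 ≤ G.card ∧ G.card ≤ 14 → FatBasis N G 5 4) → LocalShadowHall N 5 G)
    (h32 : ∀ (N : Matroid α') [N.Finite] (G : Finset α'), CellHyp N G →
      (gr N \ G).card = 3 → kColoops N G = 2 → FatMember N G 4 2 → LocalShadowHall N 5 G)
    (M : Matroid α') [M.Finite] : ShadowHall M 7 5 (phiK 7 5) := by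
  apply shadowHall_seven_five_of_residuesP h20 h21 _ h31 h32
  intro N _ G hcell hd hk hG11 hfm _ _ _
  obtain ⟨B₀, hB₀, -, hfat⟩ := hfm
  exact localShadowHall_three_zero_six_eleven hcell.2.2.2 hd hk hcell.1 hcell.2.1 hG11 hB₀ hfat

end SevenFiveQ

end PercRepro.Shadow
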